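import Summits.BirchSwinnertonDyer.Rank1Residual.Supersingular.X6KimTamDefectRecordsC
import Summits.BirchSwinnertonDyer.Rank1Residual.Supersingular.X6RankZeroLeafTarget
import Literature.NumberTheory.EllipticCurves.LocalTorsionGoodReductionProofs
import HarnessLib

/-!
# Leaf `ClassX6 ∧ r_an = 0` (A6), residual `EisensteinHalfFiveLeRest` of route `PrintX6`: the last Rest cell `(399190l1, p = 7)` —
# its LOWER half `MissingLowerBoundAt W 7` (the residual's own statement) from ONE depth-2 Kurihara number through the PROOF-COVERED twin
# of C.-H. Kim's structure theorem, with NO Perrin-Riou Prop. 4.8 and NO flagged fact (cell `bsd-print-x6`, seat p4 gen 3;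
# helper for stmt-BirchSwinnertonDyer-21116; closes no item)

PARTITION currency (D-0054): leaf A6 = X6 ∧ r_an = 0; ONE cell of the declared residual (Tam-defect: `∏c = 42`, `ord₇ = 1`, every bad
prime `2, 5, 11, 19, 191` split multiplicative, `¬ HasErratumPrime`); per pair; nothing booked; BEYOND-PRINT THEOREM: **NO**.

WHY. The road of record `bsdp_x6r0tam_399190l1_7` (`X6KimTamDefectRecordsC`, x10b gen 29) threads TWO inputs outside the cell's
flag-free base: Kim 2026 Thm 1.8 (6) beyond the unit case, `Kim2026.rankZero_le_padicValNat_sha_of_kuriharaNumber_ne_zero` (ARM-P flag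
`K26-(6)-shallow@t>0`), for the LOWER half, and Perrin-Riou 2003 Prop. 4.8 (route rationale: flag `PR03-Prop4.8-Kato-attribution`) for
the UPPER half. The residual child `EisensteinHalfFiveLeRest` is a LOWER bound only, and the route's own `UpperHalfX6` (PROVED from
`PublishedInputsX6`) replaces Prop. 4.8 — so this file stops at the lower half and re-threads it through the PROOF-COVERED twin
`Kim2026.rankZero_le_padicValNat_sha_of_kuriharaNumber_ne_zero_of_localTorsionTrivial`, whose binder `#E(ℚ₇)[7] = 1` the PROVED bridge
`Kim2026.rankZero_le_padicValNat_sha_of_kuriharaNumber_ne_zero_of_nonAnomalous` discharges from good reduction and `7 ∤ a₇ − 1` (`a₇ = 0`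
on X6). Layers (each = the landed one VERBATIM with `hKim` re-typed and the upper half dropped): §1 `X4.padicValRat_shaAn_le_of_kimLower`
→ `X6RankZero.padicValRat_shaAn_le_of_kimLowerLT`; `X4.missingLowerBoundAt_rankZero_of_kimLower` → `X6RankZero.missingLowerBoundAt_of_kimLowerLT`;
§2 the record shape `X6RankZero.bsdp_of_kimLower_of_prop48_of_ainvs` minus `h48` → `X6RankZero.missingLowerBoundAt_of_kimLowerLT_of_ainvs`;
§3 the cell, reusing the record's kernel lemmas (`isGloballyMinimal_c399190l1`, `countPoints_c399190l1_6763/23227`, the cyclicity ladders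
`card_torsion_le_c399190l1_{6763,23227}_7`, `countPoints_eq_of_fast`) and its displayed binders (`r_an = 0`, `2 ≤ ord₇ ∏c + 1`, the Manin
datum `D` with `7 ∤ c_D`, the period transfer, `ψ`, the depth-2 Kurihara number `hδ` — engine Q kit j247638 / j255441, as displayed by the road
of record). With `PrintX6`'s `UpperHalfX6` a `Theorems/PrintX6*` vehicle closes `BSD(E,7)` at the cell on the route's trust base.

THEOREMS ONLY; no definition, no named fact. References: [Kim2022StructureSelmer] Thm. 1.9 (6), §1.5.1–1.5.3, Prop. 3.2;
[Miller2011LMS] Def. 1.1; [SilvermanAEC2009] VII.3.1, VII.5.1; [Cremona2006] Table 1 (399190l1).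
-/

set_option autoImplicit false

noncomputable section

open scoped Classical MatrixGroups ModularForm

open CongruenceSubgroup WeierstrassCurve Literature.NumberTheory.EllipticCurves
  Literature.NumberTheory.EllipticCurves.ModularForms
  Literature.NumberTheory.EllipticCurves.Rank1Residual
  Literature.NumberTheory.EllipticCurves.Rank1Residual.Typed
  Literature.NumberTheory.EllipticCurves.Rank1Residual.X11RankOneCertificates
  Summit.BirchSwinnertonDyer.BirchSwinnertonDyer.Rank1Residual.IntModel
  Summit.BirchSwinnertonDyer.BirchSwinnertonDyer.Rank1Residual.X11RankOne
  Summit.BirchSwinnertonDyer.Rank1Residual.X11b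
  Summit.BirchSwinnertonDyer.Rank1Residual.Additive
  Summit.BirchSwinnertonDyer.Rank1Residual.Supersingular.KuriharaTwist

namespace Summit.BirchSwinnertonDyer.Rank1Residual.Supersingular

/-! ### §1 The lower half from a depth-`k` Kurihara number, proof-covered twin, on X6 -/

section Generic

variable (W : WeierstrassCurve ℚ) [W.IsElliptic] [W.IsGloballyMinimal] (p : ℕ) [hp : Fact p.Prime]

/-- **The raw reading of a depth-`k` Kurihara number on X6 ∧ `r_an = 0` ∧ `p ≥ 5`, through the PROOF-COVERED Kim twin** — the statement of
`X4.padicValRat_shaAn_le_of_kimLower` with `hKim` the twin `Kim2026.rankZero_le_padicValNat_sha_of_kuriharaNumber_ne_zero_of_localTorsionTrivial`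
and the class hypothesis `ClassX6 W p` in place of `Surj W p` (surjectivity by `ClassX6.surj`; good reduction and `p ∤ a_p − 1` — `a_p = 0`,
`ClassX6.frobeniusTrace_eq_zero` — discharge the twin's local-torsion binder via `…_of_nonAnomalous`): `#Ш_an = q ∈ ℚ` with
`ord_p q + ord_p ∏c_ℓ ≤ ord_p #Ш + (k − 1)`. Proof verbatim otherwise. Per pair. [cite: Kim2022StructureSelmer, Thm. 1.9 (6) (PDF p. 8), §1.5.1 (PDF p. 7), Prop. 3.2 (PDF p. 15)]
[cite: Miller2011LMS, Def. 1.1] -/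
theorem X6RankZero.padicValRat_shaAn_le_of_kimLowerLT
    (hKim : Kim2026.rankZero_le_padicValNat_sha_of_kuriharaNumber_ne_zero_of_localTorsionTrivial)
    (hGZK : rank_eq_analyticRank_of_analyticRank_le_one) (hp5 : 5 ≤ p)
    (hX : ClassX6 W p) (hL : W.entireLFunction 1 ≠ 0)
    {N : ℕ} [NeZero N] (D : ModularParametrizationData W N) (hc : ¬ (p : ℤ) ∣ D.maninConstant)
    (hper : ∃ u : ℚ, ‖(u : ℚ_[p])‖ = 1 ∧ W.realPeriodRat = u * plusPeriod D.f)
    (k n : ℕ) [NeZero n] (hk : 1 ≤ k) (hn : Kato.IsKolyvaginProduct W p k n)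
    (hcyc : ∀ (ℓ : ℕ) [Fact ℓ.Prime], ℓ ∣ n →
      Nat.card {P : ((WeierstrassCurve.integralModelInt W).map
          (Int.castRingHom (ZMod ℓ))).toAffine.Point // p • P = 0} ≤ p)
    (ψ : (ℓ : ℕ) → (ZMod ℓ)ˣ →* Multiplicative (ZMod (p ^ k)))
    (hψ : ∀ ℓ ∈ n.primeFactors, Function.Surjective (ψ ℓ))
    (hδ : kuriharaNumber D.f (p ^ k) n ψ ≠ 0) :
    ∃ q : ℚ, shaAn W = (q : ℂ) ∧
      padicValRat p q + padicValNat p W.tamagawaProduct ≤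
        padicValNat p W.shaOrder + ((k - 1 : ℕ) : ℤ) := by
  have hp2 : p ≠ 2 := by omega
  have hsurj : Surj W p := ClassX6.surj W p hp2 hX
  have hna : ¬ (p : ℤ) ∣ W.frobeniusTrace p - 1 := by
    rw [ClassX6.frobeniusTrace_eq_zero W p hp2 hX, zero_sub, dvd_neg]
    intro h
    have h1 : p ∣ 1 := by exact_mod_cast h
    have := Nat.le_of_dvd one_pos h1
    omega
  have hr0 : W.analyticRank = 0 := analyticRank_eq_zero_of_entireLFunction_one_ne_zero W hL
  obtain ⟨-, hfin⟩ := hGZK W (by rw [hr0]; exact zero_le_one)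
  haveI : Finite W.sha := hfin
  obtain ⟨t, ht, hval⟩ := Kim2026.rankZero_le_padicValNat_sha_of_kuriharaNumber_ne_zero_of_nonAnomalous hKim W p hp5
    hX.1.1 hna hsurj hL hfin D hc hper k n hk hn hcyc ψ hψ hδ
  have hΩC : (W.realPeriodRat : ℂ) ≠ 0 := Complex.ofReal_ne_zero.mpr W.realPeriodRat_pos_holds.ne'
  have ht0 : t ≠ 0 := by
    rintro rfl
    apply hL
    have h := ht
    rw [div_eq_iff hΩC] at h
    rw [h]; simp
  have hirr : W.HasIrreducibleModPGaloisRep p :=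
    hasIrreducibleModPGaloisRep_of_hasSurjectiveModNGaloisRep W p hsurj
  have hsha : padicValNat p (Nat.card (AddCommGroup.primaryComponent W.sha p)) =
      padicValNat p W.shaOrder := by
    unfold WeierstrassCurve.shaOrder
    exact padicValNat_card_addPrimaryComponent p
  refine ⟨t * (W.torsionOrder : ℚ) ^ 2 / (W.tamagawaProduct : ℚ),
    shaAn_eq_of_analyticRank_eq_zero W hGZK hr0 ht, ?_⟩
  rw [padicValRat_shaAn_witness W p hirr ht0, ← hsha]
  linarith

/-- **The typed LOWER half on X6 ∧ `r_an = 0` ∧ `p ≥ 5` from a depth-`k` Kurihara number with `k ≤ ord_p ∏c_ℓ + 1`, proof-covered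
twin** — the statement of `X4.missingLowerBoundAt_rankZero_of_kimLower` over `X6RankZero.padicValRat_shaAn_le_of_kimLowerLT`
(`ClassX6 W p` in place of `Surj W p`): `MissingLowerBoundAt W p`, i.e. `ord_p #Ш_an ≤ ord_p #Ш(E/ℚ)`. No upper-half input. Per pair.
[cite: Kim2022StructureSelmer, Thm. 1.9 (6) (PDF p. 8) and §1.5.1–1.5.3 (PDF pp. 7–8)] [cite: Miller2011LMS, Def. 1.1] -/
theorem X6RankZero.missingLowerBoundAt_of_kimLowerLT
    (hKim : Kim2026.rankZero_le_padicValNat_sha_of_kuriharaNumber_ne_zero_of_localTorsionTrivial)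
    (hGZK : rank_eq_analyticRank_of_analyticRank_le_one) (hp5 : 5 ≤ p)
    (hX : ClassX6 W p) (hL : W.entireLFunction 1 ≠ 0)
    {N : ℕ} [NeZero N] (D : ModularParametrizationData W N) (hc : ¬ (p : ℤ) ∣ D.maninConstant)
    (hper : ∃ u : ℚ, ‖(u : ℚ_[p])‖ = 1 ∧ W.realPeriodRat = u * plusPeriod D.f)
    (k n : ℕ) [NeZero n] (hk : 1 ≤ k) (hkt : k ≤ padicValNat p W.tamagawaProduct + 1)
    (hn : Kato.IsKolyvaginProduct W p k n)
    (hcyc : ∀ (ℓ : ℕ) [Fact ℓ.Prime], ℓ ∣ n →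
      Nat.card {P : ((WeierstrassCurve.integralModelInt W).map
          (Int.castRingHom (ZMod ℓ))).toAffine.Point // p • P = 0} ≤ p)
    (ψ : (ℓ : ℕ) → (ZMod ℓ)ˣ →* Multiplicative (ZMod (p ^ k)))
    (hψ : ∀ ℓ ∈ n.primeFactors, Function.Surjective (ψ ℓ))
    (hδ : kuriharaNumber D.f (p ^ k) n ψ ≠ 0) : MissingLowerBoundAt W p := by
  obtain ⟨q, hq, hv⟩ := X6RankZero.padicValRat_shaAn_le_of_kimLowerLT W p hKim hGZK hp5 hX hL D hc hper k n hk
    hn hcyc ψ hψ hδ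
  refine ⟨q, hq, ?_⟩
  have hkt' : ((k - 1 : ℕ) : ℤ) ≤ (padicValNat p W.tamagawaProduct : ℤ) := by
    have : k - 1 ≤ padicValNat p W.tamagawaProduct := by omega
    exact_mod_cast this
  linarith

end Generic

/-! ### §2 The literal-equation record shape (two-prime level `ℓ₁ℓ₂ ∈ 𝒩_k`), lower half only -/

/-- **N4 TAM-DEFECT RECORD SHAPE, LOWER HALF ONLY, proof-covered twin** — the statement of `X6RankZero.bsdp_of_kimLower_of_prop48_of_ainvs`
(`X6KimTamDefectShape.lean`) minus the Perrin-Riou binder `h48` and minus modularity, with `hKim` re-typed to the twin and `hr0` replaced by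
`L(E,1) ≠ 0` only through `hmod`; conclusion `MissingLowerBoundAt` instead of `BSDp`. Body verbatim (class X6 from the model, Kolyvagin
level of depth `k` and cyclicity from the kernel data), ending in `X6RankZero.missingLowerBoundAt_of_kimLowerLT`. Per pair; NOT a class theorem.
[cite: Kim2022StructureSelmer, Thm. 1.9 (6) (PDF p. 8), §1.2.2 (PDF p. 5) and §1.5.1–1.5.3 (PDF pp. 7–8)]
[cite: SilvermanAEC2009, VII.1 Remark 1.1, VII.5 Prop. 5.1(a) and (b)] [cite: IrelandRosen1990, Prop. 5.1.2 and §8.1] [cite: Miller2011LMS, Def. 1.1] -/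
theorem X6RankZero.missingLowerBoundAt_of_kimLowerLT_of_ainvs
    (hKim : Kim2026.rankZero_le_padicValNat_sha_of_kuriharaNumber_ne_zero_of_localTorsionTrivial)
    (hGZK : rank_eq_analyticRank_of_analyticRank_le_one) (hmod : hasEntireLFunction_rat)
    (a1 a2 a3 a4 a6 : ℤ) (hmin : (⟨a1, a2, a3, a4, a6⟩ : WeierstrassCurve ℚ).IsGloballyMinimal)
    (p : ℕ) [Fact p.Prime] (hp5 : 5 ≤ p)
    (hpΔ : ¬ (p : ℤ) ∣ discOf [a1, a2, a3, a4, a6]) {np : ℕ} (hcnt : countPoints [a1, a2, a3, a4, a6] p = np)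
    (hap : (p : ℤ) ∣ (p : ℤ) + 1 - np) (hgcd : Int.gcd (discOf [a1, a2, a3, a4, a6]) (c4Of [a1, a2, a3, a4, a6]) = 1)
    -- the cyclic level `ℓ₁ℓ₂ ∈ 𝒩_k`
    (k : ℕ) (hk : 1 ≤ k) (ℓ₁ ℓ₂ : ℕ) [Fact ℓ₁.Prime] [Fact ℓ₂.Prime] (hne : ℓ₁ ≠ ℓ₂)
    (hℓ₁p : ℓ₁ ≠ p) (hℓ₂p : ℓ₂ ≠ p) (hℓ₁2 : ℓ₁ ≠ 2) (hℓ₂2 : ℓ₂ ≠ 2)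
    (hℓ₁Δ : ¬ (ℓ₁ : ℤ) ∣ discOf [a1, a2, a3, a4, a6]) (hℓ₂Δ : ¬ (ℓ₂ : ℤ) ∣ discOf [a1, a2, a3, a4, a6])
    (h1₁ : ℓ₁ ≡ 1 [MOD p ^ k]) (h1₂ : ℓ₂ ≡ 1 [MOD p ^ k]) {n₁ n₂ : ℕ}
    (hc₁ : countPoints [a1, a2, a3, a4, a6] ℓ₁ = n₁) (hc₂ : countPoints [a1, a2, a3, a4, a6] ℓ₂ = n₂)
    (hd₁ : p ^ k ∣ n₁) (hd₂ : p ^ k ∣ n₂)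
    (hcyc₁ : Nat.card {P : (((⟨a1, a2, a3, a4, a6⟩ : WeierstrassCurve ℤ)).map
        (Int.castRingHom (ZMod ℓ₁))).toAffine.Point // p • P = 0} ≤ p)
    (hcyc₂ : Nat.card {P : (((⟨a1, a2, a3, a4, a6⟩ : WeierstrassCurve ℤ)).map
        (Int.castRingHom (ZMod ℓ₂))).toAffine.Point // p • P = 0} ≤ p)
    -- data binders
    (hr0 : (⟨a1, a2, a3, a4, a6⟩ : WeierstrassCurve ℚ).analyticRank = 0)
    (hkt : k ≤ padicValNat p (⟨a1, a2, a3, a4, a6⟩ : WeierstrassCurve ℚ).tamagawaProduct + 1)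
    {N : ℕ} [NeZero N] (D : ModularParametrizationData (⟨a1, a2, a3, a4, a6⟩ : WeierstrassCurve ℚ) N)
    (hc : ¬ (p : ℤ) ∣ D.maninConstant)
    (hper : ∃ u : ℚ, ‖(u : ℚ_[p])‖ = 1 ∧
      (⟨a1, a2, a3, a4, a6⟩ : WeierstrassCurve ℚ).realPeriodRat = u * plusPeriod D.f)
    (ψ : (ℓ : ℕ) → (ZMod ℓ)ˣ →* Multiplicative (ZMod (p ^ k)))
    (hψ₁ : Function.Surjective (ψ ℓ₁)) (hψ₂ : Function.Surjective (ψ ℓ₂))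
    (hδ : kuriharaNumber D.f (p ^ k) (ℓ₁ * ℓ₂) ψ ≠ 0) :
    MissingLowerBoundAt (⟨a1, a2, a3, a4, a6⟩ : WeierstrassCurve ℚ) p := by
  have h0 : discOf [a1, a2, a3, a4, a6] ≠ 0 := fun h ↦ hpΔ (by rw [h]; exact dvd_zero _)
  haveI := isElliptic_of_discOf_ne_zero a1 a2 a3 a4 a6 h0
  haveI := hmin
  have hp2 : p ≠ 2 := by omega
  have hI : integralModelInt (⟨a1, a2, a3, a4, a6⟩ : WeierstrassCurve ℚ) = ⟨a1, a2, a3, a4, a6⟩ :=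
    integralModelInt_eq_of_map_eq _ (map_mk_int a1 a2 a3 a4 a6)
  have hN₁ := natCard_point_eq_of_countPoints a1 a2 a3 a4 a6 ℓ₁ hℓ₁2 hℓ₁Δ hc₁
  have hN₂ := natCard_point_eq_of_countPoints a1 a2 a3 a4 a6 ℓ₂ hℓ₂2 hℓ₂Δ hc₂
  -- class X6 at `p`
  have hX : ClassX6 (⟨a1, a2, a3, a4, a6⟩ : WeierstrassCurve ℚ) p :=
    classX6_of_intModel p hp5 hI (by rw [intCurve_Δ]; exact hpΔ)
      (natCard_point_eq_of_countPoints a1 a2 a3 a4 a6 p hp2 hpΔ hcnt) hap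
      (by rw [intCurve_Δ, intCurve_c₄]; exact hgcd)
  -- the Kolyvagin level of depth `k`
  have hK₁ : Kato.IsKolyvaginPrime (⟨a1, a2, a3, a4, a6⟩ : WeierstrassCurve ℚ) p k ℓ₁ :=
    Additive.isKolyvaginPrime_of_intModel_of_card hI p k ℓ₁ hℓ₁p (by rw [intCurve_Δ]; exact hℓ₁Δ) h1₁ hN₁ hd₁
  have hK₂ : Kato.IsKolyvaginPrime (⟨a1, a2, a3, a4, a6⟩ : WeierstrassCurve ℚ) p k ℓ₂ :=
    Additive.isKolyvaginPrime_of_intModel_of_card hI p k ℓ₂ hℓ₂p (by rw [intCurve_Δ]; exact hℓ₂Δ) h1₂ hN₂ hd₂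
  have hn : Kato.IsKolyvaginProduct (⟨a1, a2, a3, a4, a6⟩ : WeierstrassCurve ℚ) p k (ℓ₁ * ℓ₂) :=
    Additive.isKolyvaginProduct_mul hK₁ hK₂ hne
  haveI : NeZero (ℓ₁ * ℓ₂) := ⟨Nat.mul_ne_zero (Fact.out : ℓ₁.Prime).ne_zero (Fact.out : ℓ₂.Prime).ne_zero⟩
  -- cyclicity at both level primes, in the consumer's `integralModelInt` form
  have hcyc : ∀ (ℓ : ℕ) [Fact ℓ.Prime], ℓ ∣ ℓ₁ * ℓ₂ →
      Nat.card {P : ((WeierstrassCurve.integralModelInt (⟨a1, a2, a3, a4, a6⟩ : WeierstrassCurve ℚ)).map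
          (Int.castRingHom (ZMod ℓ))).toAffine.Point // p • P = 0} ≤ p := by
    rw [hI]
    exact forall_card_torsion_le_of_level ⟨a1, a2, a3, a4, a6⟩ p (ℓ₁ * ℓ₂) ℓ₁ ℓ₂ rfl hcyc₁ hcyc₂
  have hL : (⟨a1, a2, a3, a4, a6⟩ : WeierstrassCurve ℚ).entireLFunction 1 ≠ 0 :=
    ((⟨a1, a2, a3, a4, a6⟩ : WeierstrassCurve ℚ).analyticRank_eq_zero_iff_holds (hmod _)).1 hr0
  exact X6RankZero.missingLowerBoundAt_of_kimLowerLT _ p hKim hGZK hp5 hX hL D hc hper k (ℓ₁ * ℓ₂) hk hkt hn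
    hcyc ψ (surjective_family_of_mem_primeFactors_mul Fact.out Fact.out ψ hψ₁ hψ₂) hδ

/-! ### §3 The cell `(399190l1, 7)` -/

/-- **`399190l1` @ `7`: the typed LOWER half `MissingLowerBoundAt W 7` from ONE depth-2 Kurihara number through the proof-covered Kim
twin — NO Perrin-Riou Prop. 4.8, no flagged fact.** Exactly the data of the road of record `bsdp_x6r0tam_399190l1_7` (N4 TAM-DEFECT cell:
`N = 399190 = 2·5·11·19·191`, good supersingular at `7`, `∏c_ℓ = 42` (`ord₇ = 1`), `#Ш_an = 49`, Cremona model
`[1, −1, 1, −8615202972, −2594053676135591]`, optimal, Manin constant 1; the cyclic level `157084201 = 6763·23227 ∈ 𝒩₂`: `6763 ≡ 23227 ≡ 1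
(mod 49)`, `#Ẽ(𝔽₆₇₆₃) = 6664`, `#Ẽ(𝔽₂₃₂₂₇) = 23373`, cyclicity ladders — all the record's KERNEL lemmas reused by name), through
`X6RankZero.missingLowerBoundAt_of_kimLowerLT_of_ainvs`. BINDERS — `hKim` (twin, UNFLAGGED), `hGZK`, `hmod`, `r_an = 0`, `2 ≤ ord₇ ∏c + 1`
(Cremona), `D` with `7 ∤ c_D`, the period transfer, a surjective `ψ`, and `hδ` = `δ̃⁽²⁾` at `157084201` non-zero mod `49` (engine Q, kit
j247638 / j255441, as displayed by the road of record). Per pair; class X6 unchanged; nothing booked.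
[cite: Kim2022StructureSelmer, Thm. 1.9 (6) (PDF p. 8) and §1.5.3 (PDF p. 8)] [cite: SilvermanAEC2009, III.2.3 and VII.5 Prop. 5.1]
[cite: Kraus1989, Prop. 1 and Prop. 2] [cite: Cremona2006, Table 1 (Cremona label 399190l1)] -/
theorem X6RankZero.missingLowerBoundAt_cell_399190l1_at7_LT [Fact (Nat.Prime 7)]
    (hKim : Kim2026.rankZero_le_padicValNat_sha_of_kuriharaNumber_ne_zero_of_localTorsionTrivial)
    (hGZK : rank_eq_analyticRank_of_analyticRank_le_one) (hmod : hasEntireLFunction_rat)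
    {W : WeierstrassCurve ℚ} [W.IsElliptic] [W.IsGloballyMinimal]
    (hW : W = ⟨1, -1, 1, -8615202972, -2594053676135591⟩) (hr0 : W.analyticRank = 0)
    (hkt : 2 ≤ padicValNat 7 W.tamagawaProduct + 1)
    {N : ℕ} [NeZero N] (D : ModularParametrizationData W N) (hc : ¬ (7 : ℤ) ∣ D.maninConstant)
    (hper : ∃ u : ℚ, ‖(u : ℚ_[7])‖ = 1 ∧ W.realPeriodRat = u * plusPeriod D.f)
    (ψ : (ℓ : ℕ) → (ZMod ℓ)ˣ →* Multiplicative (ZMod (7 ^ 2)))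
    (hψ₁ : Function.Surjective (ψ 6763)) (hψ₂ : Function.Surjective (ψ 23227))
    (hδ : kuriharaNumber D.f (7 ^ 2) (6763 * 23227) ψ ≠ 0) : MissingLowerBoundAt W 7 := by
  subst hW
  haveI : Fact (Nat.Prime 6763) := ⟨by norm_num⟩
  haveI : Fact (Nat.Prime 23227) := ⟨by norm_num⟩
  exact X6RankZero.missingLowerBoundAt_of_kimLowerLT_of_ainvs hKim hGZK hmod 1 (-1) 1 (-8615202972) (-2594053676135591)
    isGloballyMinimal_c399190l1
    7 (by norm_num) (by decide) (np := 8) (countPoints_eq_of_fast (by decide +kernel)) (by decide) (by decide +kernel)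
    2 (by norm_num) 6763 23227 (by norm_num) (by norm_num) (by norm_num) (by norm_num) (by norm_num) (by decide) (by decide)
    (by decide) (by decide) (n₁ := 6664) (n₂ := 23373) countPoints_c399190l1_6763 countPoints_c399190l1_23227 (by decide) (by decide)
    card_torsion_le_c399190l1_6763_7 card_torsion_le_c399190l1_23227_7
    hr0 hkt D hc hper ψ hψ₁ hψ₂ hδ

/-- **The Rest conclusion (= E₅'s conclusion) AT THE CELL `(399190l1, 7)`, flag-free on the lower half** — for every rational `q` with
`#Ш(E)_an = q` (and `ord₇ q ≠ 0`, unused): `ord₇ q ≤ ord₇ #Ш(E/ℚ)`, from `X6RankZero.missingLowerBoundAt_cell_399190l1_at7_LT` and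
`padicValRat_le_of_missingLowerBoundAt`. Binders as there (Kim twin, GZK, modularity; the displayed data of the road of record).
Per pair; NOT a class theorem; nothing booked. [cite: Kim2022StructureSelmer, Thm. 1.9 (6) (PDF p. 8)] [cite: Miller2011LMS, Def. 1.1]
[cite: Cremona2006, Table 1 (Cremona label 399190l1)] -/
theorem X6RankZero.eisensteinHalfFiveLeRest_cell_399190l1_at7_LT [Fact (Nat.Prime 7)]
    (hKim : Kim2026.rankZero_le_padicValNat_sha_of_kuriharaNumber_ne_zero_of_localTorsionTrivial)
    (hGZK : rank_eq_analyticRank_of_analyticRank_le_one) (hmod : hasEntireLFunction_rat)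
    {W : WeierstrassCurve ℚ} [W.IsElliptic] [W.IsGloballyMinimal]
    (hW : W = ⟨1, -1, 1, -8615202972, -2594053676135591⟩) (hr0 : W.analyticRank = 0)
    (hkt : 2 ≤ padicValNat 7 W.tamagawaProduct + 1)
    {N : ℕ} [NeZero N] (D : ModularParametrizationData W N) (hc : ¬ (7 : ℤ) ∣ D.maninConstant)
    (hper : ∃ u : ℚ, ‖(u : ℚ_[7])‖ = 1 ∧ W.realPeriodRat = u * plusPeriod D.f)
    (ψ : (ℓ : ℕ) → (ZMod ℓ)ˣ →* Multiplicative (ZMod (7 ^ 2)))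
    (hψ₁ : Function.Surjective (ψ 6763)) (hψ₂ : Function.Surjective (ψ 23227))
    (hδ : kuriharaNumber D.f (7 ^ 2) (6763 * 23227) ψ ≠ 0) :
    ∀ q : ℚ, shaAn W = (q : ℂ) → padicValRat 7 q ≠ 0 → padicValRat 7 q ≤ (padicValNat 7 W.shaOrder : ℤ) := by
  intro q hq _
  exact padicValRat_le_of_missingLowerBoundAt W 7
    (X6RankZero.missingLowerBoundAt_cell_399190l1_at7_LT hKim hGZK hmod hW hr0 hkt D hc hper ψ hψ₁ hψ₂ hδ) q hq

end Summit.BirchSwinnertonDyer.Rank1Residual.Supersingular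

end
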